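import Literature.NumberTheory.Rogawski1990.DepthZeroKappaTransferTypeOneCounts     -- ★ A-p12 `valuation_sub_one_lt_one_of_isRoot_charpoly_of_residuallyUnipotent` (+ ★ `setOf_residuallyUnipotent_endoEmbLocal_mem_nhds_one`)
import Literature.NumberTheory.Rogawski1990.UnitFundamentalLemmaInertLeviClause     -- ★ `charpoly_map_endoEmbLocal_conj` (+ ★ `endoEmbLocal_eq_glDiagonal_of_fst_eq`)
import HarnessLib

/-!
# Near `1`, every Levi-type class of `H_v` is DEEP: the three eigenvalues of `ι_v(yγ_Hy⁻¹) = diag(d′₀, u, d′₁)` are `≡ 1 (mod 𝔪_w)`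
(Rogawski (1990) §4.9 p. 54, §3.1 p. 19)

Topic `NumberTheory/Rogawski1990`; namespace `Literature.NumberTheory.Rogawski1990`.  KERNEL mathematics only: theorems, no definition, no named fact, no instance,
no notation, no `sorry`.  Cell `pub/hodgecm-mathlib`, road «S3-tree», T3′ «DEPTH-ZERO κ-TRANSFER» population P-3 «LEVI», organ **(O1) «NEAR-1 ⇒ DEEP»** of the clause
`stub_T3prime_levi` (architect A-114 ∕ A-134; seat F0P3a-p04 (g17); consumer F0P3a-p01's assembly (O5) BY NAME).  HONEST LABEL: HC_CM is proved only modulo the 2 remaining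
named inputs (hLiu418, h413) until rung 0 closes; this file discharges no named fact.

THE MATHEMATICS.  `V := {γ_H ∈ H_v | coeffᵢ χ(ι_v(γ_H)_w) ≡ coeffᵢ (X − 1)³ (mod 𝔪_w), i < 3}` is a neighbourhood of `1` (★ A-p16 `setOf_residuallyUnipotent_endoEmbLocal_mem_nhds_one`,
the uniform `V` of the P-1 assembly).  The condition is a CLASS FUNCTION of `γ_H` (`χ(ι_v(yγ_Hy⁻¹)_w) = χ(ι_v(γ_H)_w)`, ★ `charpoly_map_endoEmbLocal_conj`), and on the Levi
stratum `ι_v(yγ_Hy⁻¹) = diag(d)` the roots of `χ = ∏ (X − d_{k,w})` are the `d_{k,w}`; a root of a residually-`(X−1)³` monic cubic is `≡ 1` (★ A-p12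
`valuation_sub_one_lt_one_of_isRoot_charpoly_of_residuallyUnipotent`).  Hence **`|d_{k,w} − 1|_w < 1` for `k = 0, 1, 2`** — the `ht1` binder of ★
`classOrbitalIntegral_eq_mul_rankStrata_of_torus_deep` ((O2)-GEN) and of the ★ L-δ heads (`k = 0, 2`), uniformly on `V`.
* `valued_sub_one_lt_one_of_residuallyUnipotent_of_endoEmbLocal_conj_eq` (pointwise), `…_of_fst_eq` (in the `∃ y d′` tokens of HEAD v4's Levi hypothesis),
  `exists_nhds_one_forall_levi_deep` (the packaged `∃ V ∈ 𝓝 1`).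

## References
* [Rogawski1990] J. D. Rogawski, *Automorphic Representations of Unitary Groups in Three Variables*, Ann. of Math. Stud. 123 (1990), §3.1 p. 19; §4.9 p. 54.
* [BernsteinZelevinsky1976] I. N. Bernstein, A. V. Zelevinsky, *Representations of the group GL(n, F) where F is a non-archimedean local field*, §1.1 (neighbourhood bases).
-/

set_option autoImplicit false

noncomputable section

open NumberField IsDedekindDomain Matrix Polynomial Topology Filter
open scoped Matrix MatrixGroups

namespace Literature.NumberTheory.Rogawski1990

open Literature.NumberTheory.Automorphic Literature.NumberTheory.Automorphic.UnitaryGroup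

variable (L : Type) [Field L] [NumberField L] [IsCMField L] {v : HeightOneSpectrum (𝓞 ↥(maximalRealSubfield L))} (w : PlacesOver L v)

set_option maxHeartbeats 400000 in
-- heartbeat budget: cold instance-term unification on the CM local carriers (custody N1, buildfix bf1-g41)
/-- **RESIDUALLY UNIPOTENT + LEVI ⇒ DEEP (pointwise).**  If `coeffᵢ χ(ι_v(γ_H)_w) ≡ coeffᵢ χ(1)` for `i < 3` (the membership text of ★
`setOf_residuallyUnipotent_endoEmbLocal_mem_nhds_one`) and `ι_v(yγ_Hy⁻¹) = diag(d)`, then `|d_{k,w} − 1|_w < 1` for every `k`.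
[cite: Rogawski1990, §3.1 p. 19; §4.9 p. 54] -/
theorem valued_sub_one_lt_one_of_residuallyUnipotent_of_endoEmbLocal_conj_eq
    (γH y : (cmDatum L 2 (Matrix.of fun i j : Fin 2 => if i.val + j.val + 1 = 2 then (1 : L) else 0)).Local v ×
      (cmDatum L 1 (Matrix.of fun i j : Fin 1 => if i.val + j.val + 1 = 1 then (1 : L) else 0)).Local v)
    (hγV : ∀ i < 3, Valued.v (((((endoEmbLocal L v γH).val : GL (Fin 3) (LocalRing L v)) : Matrix (Fin 3) (Fin 3) (LocalRing L v)).map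
        (Pi.evalRingHom (fun w' : PlacesOver L v => w'.1.adicCompletion L) w)).charpoly.coeff i - (1 : Matrix (Fin 3) (Fin 3) (w.1.adicCompletion L)).charpoly.coeff i) < 1)
    {d : Fin 3 → (UnitaryGroup.LocalRing L v)ˣ}
    (hι : ((endoEmbLocal L v (y * γH * y⁻¹)).val : GL (Fin 3) (UnitaryGroup.LocalRing L v)) = glDiagonal 3 (UnitaryGroup.LocalRing L v) d) (k : Fin 3) :
    Valued.v ((((d k : (UnitaryGroup.LocalRing L v)ˣ) : UnitaryGroup.LocalRing L v) w) - 1) < 1 := by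
  refine valuation_sub_one_lt_one_of_isRoot_charpoly_of_residuallyUnipotent _ hγV ?_
  -- `χ(ι_v(γ_H)_w) = χ(ι_v(yγ_Hy⁻¹)_w) = χ(diag(d_w)) = ∏ (X − d_{k,w})`
  have hch := charpoly_map_endoEmbLocal_conj L w y γH
  rw [hι, coe_glDiagonal, Matrix.diagonal_map (RingHom.map_zero (Pi.evalRingHom (fun w' : PlacesOver L v => w'.1.adicCompletion L) w)),
    Matrix.charpoly_diagonal] at hch
  rw [Polynomial.IsRoot.def, ← hch, Polynomial.eval_prod]
  exact Finset.prod_eq_zero (Finset.mem_univ k) (by rw [eval_sub, eval_X, eval_C]; exact sub_self _)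

/-- **The same in the tokens of HEAD v4's Levi hypothesis** `glDiagonal 2 d′ = (yγ_Hy⁻¹).1`: all three entries of `d = (d′₀, u, d′₁)`,
`u = (isUnit_finGammaTwo L v (yγ_Hy⁻¹)).unit` (★ `endoEmbLocal_eq_glDiagonal_of_fst_eq`), are `≡ 1 (mod 𝔪_w)`. [cite: Rogawski1990, §3.1 p. 19; §4.9 p. 54] -/
theorem valued_sub_one_lt_one_of_residuallyUnipotent_of_fst_conj_eq
    (γH y : (cmDatum L 2 (Matrix.of fun i j : Fin 2 => if i.val + j.val + 1 = 2 then (1 : L) else 0)).Local v ×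
      (cmDatum L 1 (Matrix.of fun i j : Fin 1 => if i.val + j.val + 1 = 1 then (1 : L) else 0)).Local v)
    (hγV : ∀ i < 3, Valued.v (((((endoEmbLocal L v γH).val : GL (Fin 3) (LocalRing L v)) : Matrix (Fin 3) (Fin 3) (LocalRing L v)).map
        (Pi.evalRingHom (fun w' : PlacesOver L v => w'.1.adicCompletion L) w)).charpoly.coeff i - (1 : Matrix (Fin 3) (Fin 3) (w.1.adicCompletion L)).charpoly.coeff i) < 1)
    {d' : Fin 2 → (UnitaryGroup.LocalRing L v)ˣ}
    (hd' : glDiagonal 2 (UnitaryGroup.LocalRing L v) d' = ((y * γH * y⁻¹).1.val : GL (Fin 2) (UnitaryGroup.LocalRing L v))) (k : Fin 3) :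
    Valued.v ((((![d' 0, (isUnit_finGammaTwo L v (y * γH * y⁻¹)).unit, d' 1] k : (UnitaryGroup.LocalRing L v)ˣ) : UnitaryGroup.LocalRing L v) w) - 1) < 1 :=
  valued_sub_one_lt_one_of_residuallyUnipotent_of_endoEmbLocal_conj_eq L w γH y hγV (endoEmbLocal_eq_glDiagonal_of_fst_eq L v (y * γH * y⁻¹) hd') k

/-- **NEAR `1`, LEVI ⇒ DEEP (the uniform neighbourhood).**  There is `V ∈ 𝓝 (1 : H_v)` (the residually-unipotent locus of `ι_v`, ★
`setOf_residuallyUnipotent_endoEmbLocal_mem_nhds_one`) such that for every `γ_H ∈ V`, every `y ∈ H_v` and every `d` with `ι_v(yγ_Hy⁻¹) = diag(d)`: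
`|d_{k,w} − 1|_w < 1` for all `k`. [cite: Rogawski1990, §3.1 p. 19; §4.9 p. 54] [cite: BernsteinZelevinsky1976, §1.1] -/
theorem exists_nhds_one_forall_levi_deep (v : HeightOneSpectrum (𝓞 ↥(maximalRealSubfield L))) (w : PlacesOver L v) :
    ∃ V ∈ 𝓝 (1 : (cmDatum L 2 (Matrix.of fun i j : Fin 2 => if i.val + j.val + 1 = 2 then (1 : L) else 0)).Local v ×
        (cmDatum L 1 (Matrix.of fun i j : Fin 1 => if i.val + j.val + 1 = 1 then (1 : L) else 0)).Local v),
      ∀ γH ∈ V, ∀ y : (cmDatum L 2 (Matrix.of fun i j : Fin 2 => if i.val + j.val + 1 = 2 then (1 : L) else 0)).Local v ×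
          (cmDatum L 1 (Matrix.of fun i j : Fin 1 => if i.val + j.val + 1 = 1 then (1 : L) else 0)).Local v,
        ∀ d : Fin 3 → (UnitaryGroup.LocalRing L v)ˣ,
          ((endoEmbLocal L v (y * γH * y⁻¹)).val : GL (Fin 3) (UnitaryGroup.LocalRing L v)) = glDiagonal 3 (UnitaryGroup.LocalRing L v) d →
            ∀ k : Fin 3, Valued.v ((((d k : (UnitaryGroup.LocalRing L v)ˣ) : UnitaryGroup.LocalRing L v) w) - 1) < 1 :=
  ⟨_, setOf_residuallyUnipotent_endoEmbLocal_mem_nhds_one L v w, fun γH hγV y _ hι k =>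
    valued_sub_one_lt_one_of_residuallyUnipotent_of_endoEmbLocal_conj_eq L w γH y hγV hι k⟩

end Literature.NumberTheory.Rogawski1990

end
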